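/-
Copyright: statement-level skeleton of a published paper (lit-balaban cell, Phase-2 proof seat p13, gen 11). No proof
claims beyond what the kernel checks below.
-/
import Literature.MathematicalPhysics.QuantumFieldTheory.BalabanImbrieJaffe1984to88.BIJ88Ineq5714Proof
import Literature.MathematicalPhysics.QuantumFieldTheory.BalabanImbrieJaffe1984to88.BIJ88Ineq579First
import Literature.MathematicalPhysics.QuantumFieldTheory.BalabanImbrieJaffe1984to88.BIJ88W2Localized292
import Literature.MathematicalPhysics.QuantumFieldTheory.BalabanImbrieJaffe1984to88.BIJ88SmallLetterRemainders293

/-!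
# `BalabanImbrieJaffe1984to88.BIJ88Ineq5714Bridge` — T. Bałaban, J. Imbrie, A. Jaffe, *Effective action and cluster properties
of the abelian Higgs model*, Commun. Math. Phys. **114** (1988) 257–315 [BalabanImbrieJaffe1988]: Sect. 5.7, p. 295 — THE BRIDGE
from the word-model theorems of record for the six localized families of Sect. 5.7 to p36's verbatim knitting of **(5.7.14)**:
`W₂^{(k)} = Σ_{j≤k}(W′_j + W″_j + W‴_j + W⁽ⁱᵛ⁾_j + W⁽ᵛ⁾_j + W⁽ᵛⁱ⁾_j)` with every member a `W′`-functional (`BIJ88TraceTerms579.Wprime`) of a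
word model whose INPUT hypotheses (letters, supports, rooted sums, constants) are those of `BIJ88Ineq579First.ineq579_chain` ((5.7.9)),
`BIJ88W2Localized292.abs_Wprime_le_printed_localized` (W″, W⁽ᵛⁱ⁾_{j<k}) and `BIJ88SmallLetterRemainders293.abs_Wprime_le_printed_remainder`
(W‴, W⁽ⁱᵛ⁾, W⁽ᵛ⁾, W⁽ᵛⁱ⁾_k) satisfies r16's leaf `BIJ88Sect5StatementsPart2.Ineq5714` through `BIJ88Ineq5714Proof.ineq5714_pieces`

statement-level skeleton of published theorems with citation tags; proofs where landed; nothing here is a claim about the Yang–Mills mass gap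

PDF held: `paper:balaban1988-cmp114-bij-abelian-higgs-effective-action` (journal page = PDF page + 256); pp. 291–295 [PDF 35–39]
read as IMAGES (CCITT renders `HOME/lit-balaban-p13/pages/original-p035-x2.png` … `-p039-x2.png`).

CITATION HEADER (lean-in-tree rule).  Part of the lit-balaban TYPED SKELETON (HOME `run/shared/lean/pub/lit-balaban/`): row
**C2.Eq5.7.13-5.7.15** of `HOME/lit-balaban-r16/ROWS-C2-part2.md` (claim; owner's refined flip condition (i), seat INBOX 02:51Z:
*"(5.7.14) — feed the six piece hypotheses of p36's `ineq5714_pieces` BY NAME from the statements of record … a BRIDGE file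
instantiating `ineq5714_pieces` … is the missing object"*); unit `lit-balaban-p13` (gen 11), owner r16, referee ref-5.  Built BY
NAME on p36's `BIJ88Ineq5714Proof.ineq5714_pieces` (its regime hypotheses verbatim), on the three word-model theorems named above and
on r18's `BIJ88Sect2Statements.eK`/`rLen`; nothing restated.

## The print ((5.7.14) p. 295, verbatim)

*"where X is a connected union of r(e_k)-cubes in T₁^{(k)}, W₂^{(k)}(X) = Σ_{j=0}^{k} W^{(j)′}(X) + … + W^{(j)(vi)}(X),
|W₂^{(k)}(X)| ≤ e_k^κ e^{−cr(e_k)|X|^−} + Σ_{j<k} e_j^{1−α} e^{−cr(e_k)|X|} |B_{k−j−1}(X) ∩ Λ₅^{(j)′} ∩ Λ₆^{(j+1)c}|, (5.7.14)"*; the six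
piece bounds are quoted in `BIJ88Ineq5714Proof` (pp. 291–295).

## What is kernel-checked (zero `sorry`, theorems + one definition + three hypothesis bundles, no `Prop` facts)

* §1 `nonemptyCubePolymers` (the cube sets with `|X| ≥ 1`, where p36's knitting applies), `Wprime_empty` (a word model with
  supported letters assigns `0` to the empty cube set), `ineq5714_of_nonempty` (the leaf on all cube sets from the leaf on the
  non-empty ones plus `W(∅) = 0`).
* §2 THE WORD MODELS OF RECORD as hypothesis bundles on letters/supports/selection (`structure … : Prop`, the auxiliary grading and
  rooted-sum constants existentially packed): `HighOrderModel` (= the hypotheses of `ineq579_chain`, (5.7.9)) with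
  `HighOrderModel.bound`, `LocalizedModel` (= those of `abs_Wprime_le_printed_localized`, W″/W⁽ᵛⁱ⁾) with `LocalizedModel.bound`,
  `RemainderModel` (= those of `abs_Wprime_le_printed_remainder`, W‴/W⁽ⁱᵛ⁾/W⁽ᵛ⁾/W⁽ᵛⁱ⁾_k) with `RemainderModel.bound`; each `.empty`.
* §3 **`ineq5714_wordModel`** — THE BRIDGE: for scales `j ≤ k` on one site type (model simplification, as in
  `BIJ88Eq5713Localized`), six families of word models per scale (W′_j a `HighOrderModel` at the rate `c`, order `n̄`; W″_j (`j < k`)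
  and W⁽ᵛⁱ⁾_j (`j < k`) `LocalizedModel`s at `(e_j, α, c/2, r(e_k))` with volumes `≤ lfVol j X`; W‴_j, W⁽ⁱᵛ⁾_j, W⁽ᵛ⁾_j `RemainderModel`s at
  `(c/2, r(e_j))`; W⁽ᵛⁱ⁾_k a `RemainderModel` at `(c/2, r(e_k))`), p36's regime hypotheses, and — the one hypothesis NOT fed by a
  theorem of record — the (S1)-shape bound for W″_k (p36's `h2k`, HOME/GAPS.md G-C2-p36-02: the print states no separate bound for the
  `j = k` member of the ″-family): `Ineq5714 (cubePolymers ι₀) W₂ k (eK …) lfVol (κ − τ) (α + τ) (c/2) r(e_k)` with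
  `κ = n̄ + 1 − α₁ − 2d/(4−d) − θ` ((5.7.9)'s exponent) and `W₂(X)` THE SUM OF THE SIX `Wprime` FUNCTIONALS over `j ≤ k`.
* §4 (v1.1, appended; v1 declarations byte-identical) `vol_le_mul_card` (`|X ∩ R| ≤ s·|X|`), **`LocalizedModel.s1_shape`** — the
  `j = k` member of the ″-family (p. 292: *"(Λ₅^{(k)} if j = k)"*, *"|X| is replaced by |X|⁻"*) in the (S1) shape of the `j = k` slot
  of (5.7.14): a `LocalizedModel` at `(e_k, α, c, r(e_k))` gives `|W″_k(X)| ≤ e_k^κ e^{−(c/2)r(e_k)|X|^−}` once `(c/2)r(e_k) ≥ 1` and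
  `e_k^{1−α}·s·e^{−(c/2)r(e_k)} ≤ e_k^κ` — the latter from p36-style regime hypotheses by `s1_regime` (`s ≤ r(e_k)^d ≤ e_k^{−θ}`,
  `κ − 1 + α + θ ≤ (c/2)(log e_k⁻¹)^{r−1}`, `BIJ88ScaleSums.exp_rLen_le_rpow`) — so HOME/GAPS.md G-C2-p36-02 is discharged at the model
  level; and **`ineq5714_wordModel_closed`** — the bridge with ALL SIX families fed by name (`h2k` ← `LocalizedModel.s1_shape`).
HONEST SCOPE: pure composition — every analytic input is one of the three theorems of record or p36's knitting; the region geometry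
(`vol ≤ lfVol`), the identification of the families with the print's expansions, and (in §3) `h2k` are hypotheses; §4 trades `h2k`
for the W″_k word model plus explicit regime inequalities.  NOT summit progress; NOT
continuum; NOT Clay.  Imports Literature only; modifies nothing.
-/

namespace Literature.MathematicalPhysics.QuantumFieldTheory.BalabanImbrieJaffe1984to88.BIJ88Ineq5714Bridge

open Finset
open BIJ88TraceTerms579 (letter hull wlen Wprime cubePolymers cube_mem_hull_of_bprod_apply_ne_zero K579)
open BIJ88Sect2Statements (rLen eK)
open BIJ88Sect5StatementsPart2 (PolymerSys Ineq5714)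
open BIJ88W2Localized292 (vol)
open scoped Matrix Matrix.Norms.Operator

variable {T A B : Type*} [Fintype T] [DecidableEq T] [Fintype A] [DecidableEq A] [Fintype B] [DecidableEq B]
variable {ι₀ : Type} [DecidableEq ι₀]

/-! ## §1 Non-empty cube sets and the empty one -/

/-- The polymer system of the NON-EMPTY cube sets (*"X is a connected union of r(e_k)-cubes"*, so `|X| ≥ 1`), on which p36's
knitting `BIJ88Ineq5714Proof.ineq5714_pieces` (hypothesis `1 ≤ |X|`) applies. [cite: BalabanImbrieJaffe1988, (5.7.14) p.295] -/
def nonemptyCubePolymers (ι₀ : Type) : PolymerSys := ⟨{X : Finset ι₀ // X.Nonempty}, fun X => X.1.card⟩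

omit [DecidableEq ι₀] in
/-- every polymer of `nonemptyCubePolymers` has `|X| ≥ 1`. [cite: BalabanImbrieJaffe1988, (5.7.14) p.295] -/
theorem one_le_card_nonempty (X : (nonemptyCubePolymers ι₀).Poly) : 1 ≤ (nonemptyCubePolymers ι₀).card X :=
  Finset.card_pos.mpr X.2

omit [DecidableEq A] [DecidableEq B] in
/-- A word model with supported `C`-letters assigns `0` to the EMPTY cube set: a word with empty hull has an unsupported, hence
vanishing, first letter. [cite: BalabanImbrieJaffe1988, (5.7.9) p.291] -/
theorem Wprime_empty {cube : T → ι₀} {Cl : A → Matrix T T ℝ} {sC : A → Finset ι₀} {Wl : B → Matrix T T ℝ} {sW : B → Finset ι₀}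
    (hCs : ∀ a x y, Cl a x y ≠ 0 → cube x ∈ sC a ∧ cube y ∈ sC a)
    (S : (l : ℕ) → (Fin (l + 1) → A × B) → Prop) [∀ l, DecidablePred (S l)] :
    Wprime Cl sC Wl sW S ∅ = 0 := by
  have h : ∀ l, wlen Cl sC Wl sW (l + 1) (S l) ∅ = 0 := by
    intro l
    unfold wlen
    refine Finset.sum_eq_zero fun w hw => ?_
    rw [Finset.mem_filter] at hw
    by_contra hne
    obtain ⟨x, -, hx⟩ := Finset.exists_ne_zero_of_sum_ne_zero hne
    have hmem := cube_mem_hull_of_bprod_apply_ne_zero (sW := sW) hCs l w hx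
    rw [hw.2.1] at hmem
    exact Finset.notMem_empty _ hmem
  unfold Wprime
  simp [h]

omit [DecidableEq ι₀] in
/-- the leaf (5.7.14) on ALL cube sets from the leaf on the non-empty ones and `W₂(∅) = 0`.
[cite: BalabanImbrieJaffe1988, (5.7.14) p.295] -/
theorem ineq5714_of_nonempty {W : Finset ι₀ → ℝ} {k : ℕ} {e : ℕ → ℝ} {lfVol : ℕ → Finset ι₀ → ℕ} {κ α c rk : ℝ}
    (hek : 0 ≤ e k)
    (h : Ineq5714 (nonemptyCubePolymers ι₀) (fun X => W X.1) k e (fun j X => lfVol j X.1) κ α c rk) (h0 : W ∅ = 0)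
    (hej : ∀ j, j < k → 0 ≤ e j) :
    Ineq5714 (cubePolymers ι₀) W k e lfVol κ α c rk := by
  intro X
  rcases X.eq_empty_or_nonempty with rfl | hX
  · rw [h0, abs_zero]
    exact add_nonneg (mul_nonneg (Real.rpow_nonneg hek κ) (Real.exp_nonneg _))
      (Finset.sum_nonneg fun j hj => mul_nonneg (mul_nonneg (Real.rpow_nonneg (hej j (Finset.mem_range.mp hj)) _)
        (Real.exp_nonneg _)) (Nat.cast_nonneg _))
  · exact h ⟨X, hX⟩

/-! ## §2 The three word models of record as hypothesis bundles -/

section Models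

variable (cube : T → ι₀) (Cl : A → Matrix T T ℝ) (sC : A → Finset ι₀) (Wl : B → Matrix T T ℝ) (sW : B → Finset ι₀)
  (S : (l : ℕ) → (Fin (l + 1) → A × B) → Prop)

/-- **THE (5.7.9) WORD MODEL** (`W^{(j)′}`): the input hypotheses of `BIJ88Ineq579First.ineq579_chain` at the scales `j ≤ k` —
supported letters, `W`-letters graded by their `e_j`-order (`‖W_b‖ ≤ ε^{deg b}w_b`, `deg ≥ 1`), a selection keeping only words of
total order `≥ n̄ + 1`, rooted sums `N_C, N_w` at the rate `c·r(e_k)` with `εN_CN_w < 1`, cube size `s ≤ (r(e_k)L^{k−j})^d`, the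
(2.3) regime `(c/2)r(e_k) ≥ 1`, `r(e_k)^d ≤ e_k^{−θ}`, and the constants hypothesis `ε^{n̄+1}K ≤ e_j^{n̄+1−α₁}`.
[cite: BalabanImbrieJaffe1988, (5.7.9) p.291] -/
structure HighOrderModel [∀ l, DecidablePred (S l)] (L e ε₀ r c θ α₁ : ℝ) (d j k nbar : ℕ) : Prop where
  hCs : ∀ a x y, Cl a x y ≠ 0 → cube x ∈ sC a ∧ cube y ∈ sC a
  hWs : ∀ b x y, Wl b x y ≠ 0 → cube x ∈ sW b ∧ cube y ∈ sW b
  hθ : 0 < θ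
  hc : 1 ≤ c / 2 * rLen r (eK L e ε₀ d k)
  hpoly : rLen r (eK L e ε₀ d k) ^ d ≤ eK L e ε₀ d k ^ (-θ)
  small : ∃ (s : ℕ) (deg : B → ℕ) (ε : ℝ) (wB : B → ℝ) (NC Nw : ℝ),
    (∀ cb : ι₀, (Finset.univ.filter fun x => cube x = cb).card ≤ s) ∧
    ((s : ℝ) ≤ (rLen r (eK L e ε₀ d k) * L ^ (k - j)) ^ d) ∧
    (∀ b, 1 ≤ deg b) ∧ 0 ≤ ε ∧ ε ≤ 1 ∧ (∀ b, 0 ≤ wB b) ∧ (∀ b, ‖Wl b‖ ≤ ε ^ deg b * wB b) ∧ 0 ≤ NC ∧ 0 ≤ Nw ∧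
    (∀ cb : ι₀, ∑ a, (if cb ∈ sC a then ‖Cl a‖ * Real.exp (c * rLen r (eK L e ε₀ d k) * (sC a).card) * (sC a).card
      else 0) ≤ NC) ∧
    (∀ cb : ι₀, ∑ b, (if cb ∈ sW b then wB b * Real.exp (c * rLen r (eK L e ε₀ d k) * (sW b).card) * (sW b).card
      else 0) ≤ Nw) ∧
    ε * (NC * Nw) < 1 ∧ (∀ l w, S l w → nbar + 1 ≤ ∑ i, deg (w i).2) ∧
    ε ^ (nbar + 1) * K579 (NC * Nw) (ε * (NC * Nw)) (nbar + 1) ≤ eK L e ε₀ d j ^ ((nbar : ℝ) + 1 - α₁)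

/-- **THE W″ / W⁽ᵛⁱ⁾ WORD MODEL**: the input hypotheses of `BIJ88W2Localized292.abs_Wprime_le_printed_localized` — supported letters,
marked `W`-letters (the pieces carrying `w₅`/`Ã_j`) with non-zero rows only at the region sites `Rs`, a selection keeping words with a
marked letter, rooted sums `N_C, N_W, N_M` at the rate `c·rk` with `N_CN_W < 1`, and the constants hypothesis
`N_MN_C/(2(1−N_CN_W)) ≤ e_j^{1−α}`. [cite: BalabanImbrieJaffe1988, p.292, p.294] -/
structure LocalizedModel [∀ l, DecidablePred (S l)] (Rs : Finset T) (ej α c rk : ℝ) : Prop where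
  hCs : ∀ a x y, Cl a x y ≠ 0 → cube x ∈ sC a ∧ cube y ∈ sC a
  hWs : ∀ b x y, Wl b x y ≠ 0 → cube x ∈ sW b ∧ cube y ∈ sW b
  hcrk : 0 ≤ c * rk
  small : ∃ (mk : B → Prop) (_ : DecidablePred mk) (NC NW NM : ℝ),
    (∀ b, mk b → ∀ z y, Wl b z y ≠ 0 → z ∈ Rs) ∧ 0 ≤ NC ∧ 0 ≤ NW ∧
    (∀ cb : ι₀, ∑ a, (if cb ∈ sC a then ‖Cl a‖ * Real.exp (c * rk * (sC a).card) * (sC a).card else 0) ≤ NC) ∧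
    (∀ cb : ι₀, ∑ b, (if cb ∈ sW b then ‖Wl b‖ * Real.exp (c * rk * (sW b).card) * (sW b).card else 0) ≤ NW) ∧
    (∀ cb : ι₀, ∑ b,
      (if mk b ∧ cb ∈ sW b then ‖Wl b‖ * Real.exp (c * rk * (sW b).card) * (sW b).card ^ 2 else 0) ≤ NM) ∧
    NC * NW < 1 ∧ (∀ l w, S l w → ∃ i, mk (w i).2) ∧ NM * NC / (2 * (1 - NC * NW)) ≤ ej ^ (1 - α)

/-- **THE W‴ / W⁽ⁱᵛ⁾ / W⁽ᵛ⁾ / W⁽ᵛⁱ⁾_k WORD MODEL** (*"at least one small letter"*): the input hypotheses of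
`BIJ88SmallLetterRemainders293.abs_Wprime_le_printed_remainder` — supported letters, both families graded by the number of small
factors `ε = e^{−cr(e_j)}`, a selection of total degree `≥ 1`, rooted sums at a rate `κ ≥ c·rj + 1` with `N_cN_w < 1`, cube size `s`,
and the constants hypothesis `ε·s·N_cN_w/(2(1−N_cN_w)) ≤ 1`. [cite: BalabanImbrieJaffe1988, p.293–295] -/
structure RemainderModel [∀ l, DecidablePred (S l)] (c rj : ℝ) : Prop where
  hCs : ∀ a x y, Cl a x y ≠ 0 → cube x ∈ sC a ∧ cube y ∈ sC a
  hWs : ∀ b x y, Wl b x y ≠ 0 → cube x ∈ sW b ∧ cube y ∈ sW b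
  hcrj : 0 ≤ c * rj
  small : ∃ (s : ℕ) (κ ε : ℝ) (degC : A → ℕ) (degW : B → ℕ) (cA : A → ℝ) (wB : B → ℝ) (Nc Nw : ℝ),
    (∀ cb : ι₀, (Finset.univ.filter fun x => cube x = cb).card ≤ s) ∧ c * rj + 1 ≤ κ ∧ 0 ≤ ε ∧ ε ≤ 1 ∧
    (∀ a, 0 ≤ cA a) ∧ (∀ a, ‖Cl a‖ ≤ ε ^ degC a * cA a) ∧ (∀ b, 0 ≤ wB b) ∧ (∀ b, ‖Wl b‖ ≤ ε ^ degW b * wB b) ∧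
    0 ≤ Nc ∧ 0 ≤ Nw ∧
    (∀ cb : ι₀, ∑ a, (if cb ∈ sC a then cA a * Real.exp (κ * (sC a).card) * (sC a).card else 0) ≤ Nc) ∧
    (∀ cb : ι₀, ∑ b, (if cb ∈ sW b then wB b * Real.exp (κ * (sW b).card) * (sW b).card else 0) ≤ Nw) ∧
    Nc * Nw < 1 ∧ (∀ l w, S l w → 1 ≤ ∑ i, (degC (w i).1 + degW (w i).2)) ∧
    ε * (s * (Nc * Nw / (2 * (1 - Nc * Nw)))) ≤ 1

variable {cube Cl sC Wl sW S} [∀ l, DecidablePred (S l)]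

omit [DecidableEq A] [DecidableEq B] in
/-- the (5.7.9) model delivers the printed chain: `|W′(X)| ≤ e_j^{n̄+1−α₁−2d/(4−d)−θ} e^{−(c/2)r(e_k)|X|^−}` for every cube set
(`BIJ88Ineq579First.ineq579_chain` BY NAME). [cite: BalabanImbrieJaffe1988, (5.7.9) p.291] -/
theorem HighOrderModel.bound {L e ε₀ r c θ α₁ : ℝ} {d j k nbar : ℕ} (hL : 1 < L) (he : 0 < e) (hε₀ : 0 < ε₀) (hd : d < 4)
    (hj : j ≤ k) (hek1 : eK L e ε₀ d k ≤ 1) (M : HighOrderModel cube Cl sC Wl sW S L e ε₀ r c θ α₁ d j k nbar)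
    (X : Finset ι₀) :
    |Wprime Cl sC Wl sW S X| ≤ eK L e ε₀ d j ^ ((nbar : ℝ) + 1 - α₁ - 2 * (d : ℝ) / (4 - (d : ℝ)) - θ) *
      Real.exp (-(c / 2 * rLen r (eK L e ε₀ d k)) * (cubePolymers ι₀).cardMinus X) := by
  obtain ⟨s, deg, ε, wB, NC, Nw, hs, hsd, hdeg, hε0, hε1, hwB, hWle, hNC0, hNw0, hNC, hNw, hρ, hS, hconst⟩ := M.small
  exact BIJ88Ineq579First.ineq579_chain M.hCs M.hWs hL he hε₀ hd hj hek1 M.hθ M.hc M.hpoly hs hsd deg hdeg hε0 hε1 wB hwB hWle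
    hNC0 hNw0 hNC hNw hρ S hS hconst X

omit [DecidableEq A] [DecidableEq B] in
/-- … and `W′(∅) = 0`. [cite: BalabanImbrieJaffe1988, (5.7.9) p.291] -/
theorem HighOrderModel.empty {L e ε₀ r c θ α₁ : ℝ} {d j k nbar : ℕ}
    (M : HighOrderModel cube Cl sC Wl sW S L e ε₀ r c θ α₁ d j k nbar) : Wprime Cl sC Wl sW S ∅ = 0 :=
  Wprime_empty M.hCs S

omit [DecidableEq A] [DecidableEq B] in
/-- the W″/W⁽ᵛⁱ⁾ model delivers the printed bound with its volume factor: `|W(X)| ≤ e_j^{1−α} e^{−c·rk|X|}·|X ∩ R|`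
(`BIJ88W2Localized292.abs_Wprime_le_printed_localized` BY NAME). [cite: BalabanImbrieJaffe1988, p.292, p.294] -/
theorem LocalizedModel.bound {Rs : Finset T} {ej α c rk : ℝ} (M : LocalizedModel cube Cl sC Wl sW S Rs ej α c rk)
    (X : Finset ι₀) :
    |Wprime Cl sC Wl sW S X| ≤ ej ^ (1 - α) * Real.exp (-(c * rk) * (cubePolymers ι₀).card X) * (vol cube Rs X : ℝ) := by
  obtain ⟨mk, _, NC, NW, NM, hmk, hNC0, hNW0, hNC, hNW, hNM, hρ, hS, hconst⟩ := M.small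
  exact BIJ88W2Localized292.abs_Wprime_le_printed_localized M.hCs M.hWs Rs mk hmk M.hcrk hNC0 hNW0 hNC hNW hNM hρ S hS hconst X

omit [DecidableEq A] [DecidableEq B] in
/-- … and `W(∅) = 0`. [cite: BalabanImbrieJaffe1988, p.292] -/
theorem LocalizedModel.empty {Rs : Finset T} {ej α c rk : ℝ} (M : LocalizedModel cube Cl sC Wl sW S Rs ej α c rk) :
    Wprime Cl sC Wl sW S ∅ = 0 :=
  Wprime_empty M.hCs S

omit [DecidableEq A] [DecidableEq B] in
/-- the remainder model delivers `|W(X)| ≤ e^{−c·rj|X|}` (`BIJ88SmallLetterRemainders293.abs_Wprime_le_printed_remainder` BY NAME).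
[cite: BalabanImbrieJaffe1988, p.293–295] -/
theorem RemainderModel.bound {c rj : ℝ} (M : RemainderModel cube Cl sC Wl sW S c rj) (X : Finset ι₀) :
    |Wprime Cl sC Wl sW S X| ≤ Real.exp (-(c * rj) * (cubePolymers ι₀).card X) := by
  obtain ⟨s, κ, ε, degC, degW, cA, wB, Nc, Nw, hs, hκ, hε0, hε1, hcA, hCle, hwB, hWle, hNc0, hNw0, hNc, hNw, hρ, hS, hconst⟩ :=
    M.small
  exact BIJ88SmallLetterRemainders293.abs_Wprime_le_printed_remainder M.hCs M.hWs hs M.hcrj hκ degC degW hε0 hε1 cA hcA hCle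
    wB hwB hWle hNc0 hNw0 hNc hNw hρ S hS hconst X

omit [DecidableEq A] [DecidableEq B] in
/-- … and `W(∅) = 0`. [cite: BalabanImbrieJaffe1988, p.293] -/
theorem RemainderModel.empty {c rj : ℝ} (M : RemainderModel cube Cl sC Wl sW S c rj) : Wprime Cl sC Wl sW S ∅ = 0 :=
  Wprime_empty M.hCs S

end Models

/-! ## §3 The bridge: the six families of word models ⇒ p36's knitting ⇒ the leaf (5.7.14) -/

section Bridge

/-- A SCALE-INDEXED FAMILY OF WORD MODELS on one site type: letters, supports and selection at every scale `j`
(the cube maps `cube j : T → ι₀` send the sites of the `j`-th lattice to the `r(e_k)`-cubes of `T₁^{(k)}`; the selections are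
used with `[∀ j l, DecidablePred (F.S j l)]`).
[cite: BalabanImbrieJaffe1988, (5.7.14) p.295] -/
structure Family (T A B : Type*) (ι₀ : Type) where
  /-- cube map at scale `j` -/
  cube : ℕ → T → ι₀
  /-- `C`-letters at scale `j` -/
  Cl : ℕ → A → Matrix T T ℝ
  /-- their cube supports -/
  sC : ℕ → A → Finset ι₀
  /-- `W`-letters at scale `j` -/
  Wl : ℕ → B → Matrix T T ℝ
  /-- their cube supports -/
  sW : ℕ → B → Finset ι₀
  /-- the (decidable) selection of words at scale `j` -/
  S : ℕ → (l : ℕ) → (Fin (l + 1) → A × B) → Prop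

/-- the functional `X ↦ W_j(X)` of a family at scale `j`: the `W′`-functional `BIJ88TraceTerms579.Wprime` of its word model.
[cite: BalabanImbrieJaffe1988, (5.7.9) p.291, (5.7.14) p.295] -/
noncomputable def Family.W (F : Family T A B ι₀) [∀ j l, DecidablePred (F.S j l)] (j : ℕ) (X : Finset ι₀) : ℝ :=
  Wprime (F.Cl j) (F.sC j) (F.Wl j) (F.sW j) (F.S j) X

omit [DecidableEq A] [DecidableEq B] in
/-- **(5.7.14) FROM THE WORD MODELS OF RECORD** — *"W₂^{(k)}(X) = Σ_{j=0}^{k} W^{(j)′}(X) + … + W^{(j)(vi)}(X), |W₂^{(k)}(X)| ≤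
e_k^κ e^{−cr(e_k)|X|^−} + Σ_{j<k} e_j^{1−α} e^{−cr(e_k)|X|} |B_{k−j−1}(X) ∩ Λ₅^{(j)′} ∩ Λ₆^{(j+1)c}|. (5.7.14)"*: with, on r18's running
charges `e_j = eK L e ε₀ d j` (`L > 1`, `d < 4`, `e_k ≤ 1`) and (2.3)'s `r(·)` (`r > 1`), SIX SCALE-INDEXED FAMILIES OF WORD MODELS —
`F₁` (W′: a `HighOrderModel` at every `j ≤ k`, rate `c`, order `n̄`, exponents `α₁, θ`), `F₂` (W″: a `LocalizedModel` at
`(e_j, α, c/2, r(e_k))` for `j < k` with volumes `|X ∩ R₂_j| ≤ lfVol j X`), `F₃, F₄, F₅` (W‴, W⁽ⁱᵛ⁾, W⁽ᵛ⁾: `RemainderModel`s at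
`(c/2, r(e_j))`, `j ≤ k`), `F₆` (W⁽ᵛⁱ⁾: a `LocalizedModel` at `(e_j, α, c/2, r(e_k))` for `j < k` with volumes `≤ lfVol j X`, a
`RemainderModel` at `(c/2, r(e_k))` for `j = k`) — p36's regime hypotheses (`κ = n̄+1−α₁−2d/(4−d)−θ > 0`, `τ > 0`, per-scale gain
`≥ log 2`, `κ ≤ (c/2)(log e_k⁻¹)^{r−1}`, `(2/(1−q^κ)+8)e_k^τ ≤ 1`), the supports of `F₂` at `j = k` and THE ONE BOUND NOT FED BY A
THEOREM OF RECORD, the (S1)-shape `|W″_k(X)| ≤ e_k^κ e^{−(c/2)r(e_k)|X|^−}` (p36's `h2k`, HOME/GAPS.md G-C2-p36-02): the functional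
`W₂(X) = Σ_{j≤k} (W′_j + W″_j + W‴_j + W⁽ⁱᵛ⁾_j + W⁽ᵛ⁾_j + W⁽ᵛⁱ⁾_j)(X)` of the families satisfies r16's leaf
`Ineq5714 (cubePolymers ι₀) W₂ k e lfVol (κ − τ) (α + τ) (c/2) r(e_k)` (p36's `ineq5714_pieces` on the non-empty cube sets, the
empty one carrying `W₂(∅) = 0`). [cite: BalabanImbrieJaffe1988, (5.7.14) p.295] -/
theorem ineq5714_wordModel {L e ε₀ : ℝ} {d : ℕ} (hL : 1 < L) (he : 0 < e) (hε₀ : 0 < ε₀) (hd : d < 4) (k : ℕ)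
    (hek1 : eK L e ε₀ d k ≤ 1) {r c θ α₁ α τ : ℝ} {nbar : ℕ} (hr : 1 < r) (hc : 0 < c) (hτ : 0 < τ)
    (hκ : 0 < (nbar : ℝ) + 1 - α₁ - 2 * (d : ℝ) / (4 - (d : ℝ)) - θ)
    (F₁ F₂ F₃ F₄ F₅ F₆ : Family T A B ι₀) [∀ j l, DecidablePred (F₁.S j l)] [∀ j l, DecidablePred (F₂.S j l)]
    [∀ j l, DecidablePred (F₃.S j l)] [∀ j l, DecidablePred (F₄.S j l)] [∀ j l, DecidablePred (F₅.S j l)]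
    [∀ j l, DecidablePred (F₆.S j l)] (R₂ R₆ : ℕ → Finset T) (lfVol : ℕ → Finset ι₀ → ℕ)
    (hvol₂ : ∀ j X, vol (F₂.cube j) (R₂ j) X ≤ lfVol j X) (hvol₆ : ∀ j X, vol (F₆.cube j) (R₆ j) X ≤ lfVol j X)
    (h1 : ∀ j, j ≤ k → HighOrderModel (F₁.cube j) (F₁.Cl j) (F₁.sC j) (F₁.Wl j) (F₁.sW j) (F₁.S j) L e ε₀ r c θ α₁ d j k nbar)
    (h2 : ∀ j, j < k → LocalizedModel (F₂.cube j) (F₂.Cl j) (F₂.sC j) (F₂.Wl j) (F₂.sW j) (F₂.S j) (R₂ j)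
      (eK L e ε₀ d j) α (c / 2) (rLen r (eK L e ε₀ d k)))
    (h2s : ∀ a x y, F₂.Cl k a x y ≠ 0 → F₂.cube k x ∈ F₂.sC k a ∧ F₂.cube k y ∈ F₂.sC k a)
    (h2k : ∀ X, |F₂.W k X| ≤ eK L e ε₀ d k ^ ((nbar : ℝ) + 1 - α₁ - 2 * (d : ℝ) / (4 - (d : ℝ)) - θ) *
      Real.exp (-(c / 2 * rLen r (eK L e ε₀ d k)) * (cubePolymers ι₀).cardMinus X))
    (h3 : ∀ j, j ≤ k → RemainderModel (F₃.cube j) (F₃.Cl j) (F₃.sC j) (F₃.Wl j) (F₃.sW j) (F₃.S j) (c / 2)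
      (rLen r (eK L e ε₀ d j)))
    (h4 : ∀ j, j ≤ k → RemainderModel (F₄.cube j) (F₄.Cl j) (F₄.sC j) (F₄.Wl j) (F₄.sW j) (F₄.S j) (c / 2)
      (rLen r (eK L e ε₀ d j)))
    (h5 : ∀ j, j ≤ k → RemainderModel (F₅.cube j) (F₅.Cl j) (F₅.sC j) (F₅.Wl j) (F₅.sW j) (F₅.S j) (c / 2)
      (rLen r (eK L e ε₀ d j)))
    (h6 : ∀ j, j < k → LocalizedModel (F₆.cube j) (F₆.Cl j) (F₆.sC j) (F₆.Wl j) (F₆.sW j) (F₆.S j) (R₆ j)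
      (eK L e ε₀ d j) α (c / 2) (rLen r (eK L e ε₀ d k)))
    (h6k : RemainderModel (F₆.cube k) (F₆.Cl k) (F₆.sC k) (F₆.Wl k) (F₆.sW k) (F₆.S k) (c / 2) (rLen r (eK L e ε₀ d k)))
    (hg : Real.log 2 ≤ c / 2 * r * Real.log (eK L e ε₀ d k)⁻¹ ^ (r - 1) * ((4 - (d : ℝ)) / 2 * Real.log L))
    (hκR : (nbar : ℝ) + 1 - α₁ - 2 * (d : ℝ) / (4 - (d : ℝ)) - θ ≤ c / 2 * Real.log (eK L e ε₀ d k)⁻¹ ^ (r - 1))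
    (hAτ : (2 / (1 - (L ^ (-((4 - (d : ℝ)) / 2))) ^ ((nbar : ℝ) + 1 - α₁ - 2 * (d : ℝ) / (4 - (d : ℝ)) - θ)) + 8) *
      eK L e ε₀ d k ^ τ ≤ 1) :
    Ineq5714 (cubePolymers ι₀)
      (fun X => ∑ j ∈ Finset.range (k + 1), (F₁.W j X + F₂.W j X + F₃.W j X + F₄.W j X + F₅.W j X + F₆.W j X))
      k (fun j => eK L e ε₀ d j) lfVol
      (((nbar : ℝ) + 1 - α₁ - 2 * (d : ℝ) / (4 - (d : ℝ)) - θ) - τ) (α + τ) (c / 2) (rLen r (eK L e ε₀ d k)) := by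
  have hL0 : 0 < L := by linarith
  have hejpos : ∀ j, 0 < eK L e ε₀ d j := fun j => BIJ88ScaleSums.eK_pos hL0 he hε₀ j
  set κ : ℝ := (nbar : ℝ) + 1 - α₁ - 2 * (d : ℝ) / (4 - (d : ℝ)) - θ with hκdef
  -- p36's knitting on the non-empty cube sets
  have hP := BIJ88Ineq5714Proof.ineq5714_pieces (nonemptyCubePolymers ι₀) (one_le_card_nonempty (ι₀ := ι₀)) hL he hε₀ hd k
    hek1 hr (half_pos hc) hκ hτ
    (fun j X => F₁.W j X.1) (fun j X => F₂.W j X.1) (fun j X => F₃.W j X.1) (fun j X => F₄.W j X.1)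
    (fun j X => F₅.W j X.1) (fun j X => F₆.W j X.1)
    (fun j X => vol (F₂.cube j) (R₂ j) X.1) (fun j X => vol (F₆.cube j) (R₆ j) X.1) (fun j X => lfVol j X.1)
    (fun j X => hvol₂ j X.1) (fun j X => hvol₆ j X.1)
    (fun j hj X => (h1 j hj).bound hL he hε₀ hd hj hek1 X.1)
    (fun j hj X => (h2 j hj).bound X.1)
    (fun X => h2k X.1)
    (fun j hj X => (h3 j hj).bound X.1) (fun j hj X => (h4 j hj).bound X.1) (fun j hj X => (h5 j hj).bound X.1)
    (fun j hj X => (h6 j hj).bound X.1) (fun X => h6k.bound X.1)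
    (fun X => ∑ j ∈ Finset.range (k + 1), (F₁.W j X.1 + F₂.W j X.1 + F₃.W j X.1 + F₄.W j X.1 + F₅.W j X.1 + F₆.W j X.1))
    (fun X => rfl) hg hκR hAτ
  -- the empty cube set
  refine ineq5714_of_nonempty (hejpos k).le hP ?_ fun j _ => (hejpos j).le
  refine Finset.sum_eq_zero fun j hj => ?_
  have hj' : j ≤ k := Nat.lt_succ_iff.mp (Finset.mem_range.mp hj)
  have e1 : F₁.W j ∅ = 0 := (h1 j hj').empty
  have e3 : F₃.W j ∅ = 0 := (h3 j hj').empty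
  have e4 : F₄.W j ∅ = 0 := (h4 j hj').empty
  have e5 : F₅.W j ∅ = 0 := (h5 j hj').empty
  have e2 : F₂.W j ∅ = 0 := by
    rcases hj'.lt_or_eq with hlt | rfl
    · exact (h2 j hlt).empty
    · exact Wprime_empty h2s (F₂.S j)
  have e6 : F₆.W j ∅ = 0 := by
    rcases hj'.lt_or_eq with hlt | rfl
    · exact (h6 j hlt).empty
    · exact h6k.empty
  rw [e1, e2, e3, e4, e5, e6]
  ring

end Bridge


/-! ## §4 The (S1) shape for `W″_k` from its localized bound (the one hypothesis of §3 not fed by name, discharged up to a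
regime inequality) -/

section S1Shape

variable {cube : T → ι₀} {Cl : A → Matrix T T ℝ} {sC : A → Finset ι₀} {Wl : B → Matrix T T ℝ} {sW : B → Finset ι₀}
  {S : (l : ℕ) → (Fin (l + 1) → A × B) → Prop} [∀ l, DecidablePred (S l)]

omit [DecidableEq T] [Fintype A] [DecidableEq A] [Fintype B] [DecidableEq B] in
/-- the volume factor is at most (sites per cube) × (number of cubes): `|X ∩ R| ≤ s·|X|`. [cite: BalabanImbrieJaffe1988, p.292] -/
theorem vol_le_mul_card {s : ℕ} (hs : ∀ cb : ι₀, (Finset.univ.filter fun x => cube x = cb).card ≤ s) (Rs : Finset T)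
    (X : Finset ι₀) : vol cube Rs X ≤ s * X.card := by
  classical
  unfold vol
  have hsub : (Rs.filter fun z => cube z ∈ X) ⊆ X.biUnion (fun cb => Finset.univ.filter fun z : T => cube z = cb) := by
    intro z hz
    rw [Finset.mem_filter] at hz
    exact Finset.mem_biUnion.mpr ⟨cube z, hz.2, Finset.mem_filter.mpr ⟨Finset.mem_univ _, rfl⟩⟩
  calc (Rs.filter fun z => cube z ∈ X).card
      ≤ (X.biUnion fun cb => Finset.univ.filter fun z : T => cube z = cb).card := Finset.card_le_card hsub
    _ ≤ ∑ cb ∈ X, (Finset.univ.filter fun z : T => cube z = cb).card := Finset.card_biUnion_le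
    _ ≤ ∑ _cb ∈ X, s := Finset.sum_le_sum fun cb _ => hs cb
    _ = s * X.card := by rw [Finset.sum_const, smul_eq_mul, mul_comm]

/-- `n·e^{−a·n} ≤ 1` for `a ≥ 1`, `n ≥ 0`. [folklore] -/
private theorem mul_exp_neg_le_one {a n : ℝ} (ha : 1 ≤ a) (hn : 0 ≤ n) : n * Real.exp (-(a * n)) ≤ 1 := by
  have h1 : n ≤ Real.exp (a * n) := by
    calc n ≤ n + 1 := by linarith
      _ ≤ Real.exp n := Real.add_one_le_exp n
      _ ≤ Real.exp (a * n) := Real.exp_le_exp.mpr (by nlinarith)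
  rw [Real.exp_neg]
  have h2 : 0 < Real.exp (a * n) := Real.exp_pos _
  rw [mul_inv_le_iff₀ h2, one_mul]
  exact h1

omit [DecidableEq A] [DecidableEq B] in
/-- **THE (S1) SHAPE FOR `W″_k`** — p. 292 for `j = k` (*"(Λ₅^{(k)} if j = k)"*, *"|X| is replaced by |X|⁻"*) against the `j = k` slot of
(5.7.14): a `LocalizedModel` at `(e_k, α, c, r(e_k))` with at most `s` sites per cube gives, once `(c/2)r(e_k) ≥ 1`,
`|W″_k(X)| ≤ e_k^{1−α}·s·e^{−(c/2)r(e_k)} · e^{−(c/2)r(e_k)|X|^−}`; so under the regime inequality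
`e_k^{1−α}·s·e^{−(c/2)r(e_k)} ≤ e_k^κ` (true for small `e_k`: `r(e_k) = (log e_k⁻¹)^r`, `r > 1`, beats every power) the hypothesis
`h2k` of `ineq5714_wordModel` / p36's `ineq5714_pieces` holds at the rate `c/2` (HOME/GAPS.md G-C2-p36-02 discharged at the model
level, up to that inequality). [cite: BalabanImbrieJaffe1988, p.292, (5.7.14) p.295] -/
theorem LocalizedModel.s1_shape {Rs : Finset T} {ek α c rk κ : ℝ} (M : LocalizedModel cube Cl sC Wl sW S Rs ek α c rk)
    {s : ℕ} (hs : ∀ cb : ι₀, (Finset.univ.filter fun x => cube x = cb).card ≤ s) (hek : 0 ≤ ek) (hcr : 1 ≤ c / 2 * rk)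
    (hsmall : ek ^ (1 - α) * s * Real.exp (-(c / 2 * rk)) ≤ ek ^ κ) (X : Finset ι₀) :
    |Wprime Cl sC Wl sW S X| ≤ ek ^ κ * Real.exp (-(c / 2 * rk) * (cubePolymers ι₀).cardMinus X) := by
  rcases X.eq_empty_or_nonempty with rfl | hX
  · rw [M.empty, abs_zero]
    exact mul_nonneg (Real.rpow_nonneg hek κ) (Real.exp_nonneg _)
  have hcard : (1 : ℝ) ≤ X.card := by exact_mod_cast Finset.card_pos.mpr hX
  have hcm : ((cubePolymers ι₀).cardMinus X : ℝ) = (X.card : ℝ) - 1 := by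
    rw [BIJ88Sect5StatementsPart2.PolymerSys.cardMinus_eq_max]
    exact max_eq_right (by simpa [cubePolymers] using hcard)
  have hvol : (vol cube Rs X : ℝ) ≤ s * X.card := by exact_mod_cast vol_le_mul_card hs Rs X
  have hexp0 : 0 < Real.exp (-(c / 2 * rk) * X.card) := Real.exp_pos _
  have hsplit : Real.exp (-(c * rk) * (cubePolymers ι₀).card X) =
      Real.exp (-(c / 2 * rk) * X.card) * Real.exp (-(c / 2 * rk) * X.card) := by
    rw [← Real.exp_add]; congr 1; simp [cubePolymers]; ring
  have hn1 : (X.card : ℝ) * Real.exp (-(c / 2 * rk) * X.card) ≤ 1 := by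
    have := mul_exp_neg_le_one hcr (Nat.cast_nonneg X.card)
    simpa [mul_comm] using this
  have hshift : Real.exp (-(c / 2 * rk) * X.card) =
      Real.exp (-(c / 2 * rk)) * Real.exp (-(c / 2 * rk) * (cubePolymers ι₀).cardMinus X) := by
    rw [← Real.exp_add, hcm]; congr 1; ring
  have hek1 : 0 ≤ ek ^ (1 - α) := Real.rpow_nonneg hek _
  calc |Wprime Cl sC Wl sW S X|
      ≤ ek ^ (1 - α) * Real.exp (-(c * rk) * (cubePolymers ι₀).card X) * (vol cube Rs X : ℝ) := M.bound X
    _ ≤ ek ^ (1 - α) * Real.exp (-(c * rk) * (cubePolymers ι₀).card X) * (s * X.card) :=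
        mul_le_mul_of_nonneg_left hvol (mul_nonneg hek1 (Real.exp_nonneg _))
    _ = ek ^ (1 - α) * s * Real.exp (-(c / 2 * rk) * X.card) * ((X.card : ℝ) * Real.exp (-(c / 2 * rk) * X.card)) := by
        rw [hsplit]; ring
    _ ≤ ek ^ (1 - α) * s * Real.exp (-(c / 2 * rk) * X.card) * 1 :=
        mul_le_mul_of_nonneg_left hn1 (mul_nonneg (mul_nonneg hek1 (Nat.cast_nonneg _)) hexp0.le)
    _ = (ek ^ (1 - α) * s * Real.exp (-(c / 2 * rk))) * Real.exp (-(c / 2 * rk) * (cubePolymers ι₀).cardMinus X) := by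
        rw [mul_one, hshift]; ring
    _ ≤ ek ^ κ * Real.exp (-(c / 2 * rk) * (cubePolymers ι₀).cardMinus X) :=
        mul_le_mul_of_nonneg_right hsmall (Real.exp_nonneg _)

omit [Fintype T] [DecidableEq T] [Fintype A] [DecidableEq A] [Fintype B] [DecidableEq B] [DecidableEq ι₀] in
/-- THE REGIME INEQUALITY of `LocalizedModel.s1_shape` in p36's style: with at most `s ≤ r(e_k)^d ≤ e_k^{−θ}` sites per cube
((2.3), the cube size at scale `k`) and `κ − 1 + α + θ ≤ (c/2)(log e_k⁻¹)^{r−1}` (`BIJ88ScaleSums.exp_rLen_le_rpow`: *"We can take κ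
arbitrarily large"*), `e_k^{1−α}·s·e^{−(c/2)r(e_k)} ≤ e_k^κ`. [cite: BalabanImbrieJaffe1988, (5.7.9) p.291, (5.7.14) p.295] -/
theorem s1_regime {ek r c θ α κ : ℝ} {d s : ℕ} (hek : 0 < ek) (hek1 : ek ≤ 1) (hr : 1 < r)
    (hsd : (s : ℝ) ≤ rLen r ek ^ d) (hpoly : rLen r ek ^ d ≤ ek ^ (-θ))
    (hκR : κ - 1 + α + θ ≤ c / 2 * Real.log ek⁻¹ ^ (r - 1)) :
    ek ^ (1 - α) * s * Real.exp (-(c / 2 * rLen r ek)) ≤ ek ^ κ := by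
  have h1 : (s : ℝ) ≤ ek ^ (-θ) := hsd.trans hpoly
  have h2 : Real.exp (-(c / 2 * rLen r ek)) ≤ ek ^ (κ - 1 + α + θ) := BIJ88ScaleSums.exp_rLen_le_rpow hek hek1 hr hκR
  have h0 : 0 ≤ ek ^ (1 - α) := Real.rpow_nonneg hek.le _
  calc ek ^ (1 - α) * s * Real.exp (-(c / 2 * rLen r ek))
      ≤ ek ^ (1 - α) * ek ^ (-θ) * ek ^ (κ - 1 + α + θ) :=
        mul_le_mul (mul_le_mul_of_nonneg_left h1 h0) h2 (Real.exp_nonneg _)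
          (mul_nonneg h0 (Real.rpow_nonneg hek.le _))
    _ = ek ^ κ := by
        rw [← Real.rpow_add hek, ← Real.rpow_add hek]
        ring_nf

end S1Shape

section BridgeClosed

omit [DecidableEq A] [DecidableEq B] in
/-- **(5.7.14) FROM THE WORD MODELS OF RECORD, ALL SIX FAMILIES BY NAME** — `ineq5714_wordModel` with its hypothesis `h2k` FED by
`LocalizedModel.s1_shape`: the W″-family is a `LocalizedModel` at `(e_j, α, c/2, r(e_k))` for `j < k` and at `(e_k, α, c, r(e_k))` for
`j = k`, the latter with `s` sites per cube, `(c/2)r(e_k) ≥ 1` and the regime inequality `e_k^{1−α}·s·e^{−(c/2)r(e_k)} ≤ e_k^κ`,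
`κ = n̄+1−α₁−2d/(4−d)−θ`. [cite: BalabanImbrieJaffe1988, (5.7.14) p.295] -/
theorem ineq5714_wordModel_closed {L e ε₀ : ℝ} {d : ℕ} (hL : 1 < L) (he : 0 < e) (hε₀ : 0 < ε₀) (hd : d < 4) (k : ℕ)
    (hek1 : eK L e ε₀ d k ≤ 1) {r c θ α₁ α τ : ℝ} {nbar : ℕ} (hr : 1 < r) (hc : 0 < c) (hτ : 0 < τ)
    (hκ : 0 < (nbar : ℝ) + 1 - α₁ - 2 * (d : ℝ) / (4 - (d : ℝ)) - θ)
    (F₁ F₂ F₃ F₄ F₅ F₆ : Family T A B ι₀) [∀ j l, DecidablePred (F₁.S j l)] [∀ j l, DecidablePred (F₂.S j l)]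
    [∀ j l, DecidablePred (F₃.S j l)] [∀ j l, DecidablePred (F₄.S j l)] [∀ j l, DecidablePred (F₅.S j l)]
    [∀ j l, DecidablePred (F₆.S j l)] (R₂ R₆ : ℕ → Finset T) (lfVol : ℕ → Finset ι₀ → ℕ)
    (hvol₂ : ∀ j X, vol (F₂.cube j) (R₂ j) X ≤ lfVol j X) (hvol₆ : ∀ j X, vol (F₆.cube j) (R₆ j) X ≤ lfVol j X)
    (h1 : ∀ j, j ≤ k → HighOrderModel (F₁.cube j) (F₁.Cl j) (F₁.sC j) (F₁.Wl j) (F₁.sW j) (F₁.S j) L e ε₀ r c θ α₁ d j k nbar)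
    (h2 : ∀ j, j < k → LocalizedModel (F₂.cube j) (F₂.Cl j) (F₂.sC j) (F₂.Wl j) (F₂.sW j) (F₂.S j) (R₂ j)
      (eK L e ε₀ d j) α (c / 2) (rLen r (eK L e ε₀ d k)))
    (h2k : LocalizedModel (F₂.cube k) (F₂.Cl k) (F₂.sC k) (F₂.Wl k) (F₂.sW k) (F₂.S k) (R₂ k)
      (eK L e ε₀ d k) α c (rLen r (eK L e ε₀ d k)))
    {s : ℕ} (hs : ∀ cb : ι₀, (Finset.univ.filter fun x => F₂.cube k x = cb).card ≤ s)
    (hcr : 1 ≤ c / 2 * rLen r (eK L e ε₀ d k))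
    (hsmall : eK L e ε₀ d k ^ (1 - α) * s * Real.exp (-(c / 2 * rLen r (eK L e ε₀ d k))) ≤
      eK L e ε₀ d k ^ ((nbar : ℝ) + 1 - α₁ - 2 * (d : ℝ) / (4 - (d : ℝ)) - θ))
    (h3 : ∀ j, j ≤ k → RemainderModel (F₃.cube j) (F₃.Cl j) (F₃.sC j) (F₃.Wl j) (F₃.sW j) (F₃.S j) (c / 2)
      (rLen r (eK L e ε₀ d j)))
    (h4 : ∀ j, j ≤ k → RemainderModel (F₄.cube j) (F₄.Cl j) (F₄.sC j) (F₄.Wl j) (F₄.sW j) (F₄.S j) (c / 2)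
      (rLen r (eK L e ε₀ d j)))
    (h5 : ∀ j, j ≤ k → RemainderModel (F₅.cube j) (F₅.Cl j) (F₅.sC j) (F₅.Wl j) (F₅.sW j) (F₅.S j) (c / 2)
      (rLen r (eK L e ε₀ d j)))
    (h6 : ∀ j, j < k → LocalizedModel (F₆.cube j) (F₆.Cl j) (F₆.sC j) (F₆.Wl j) (F₆.sW j) (F₆.S j) (R₆ j)
      (eK L e ε₀ d j) α (c / 2) (rLen r (eK L e ε₀ d k)))
    (h6k : RemainderModel (F₆.cube k) (F₆.Cl k) (F₆.sC k) (F₆.Wl k) (F₆.sW k) (F₆.S k) (c / 2) (rLen r (eK L e ε₀ d k)))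
    (hg : Real.log 2 ≤ c / 2 * r * Real.log (eK L e ε₀ d k)⁻¹ ^ (r - 1) * ((4 - (d : ℝ)) / 2 * Real.log L))
    (hκR : (nbar : ℝ) + 1 - α₁ - 2 * (d : ℝ) / (4 - (d : ℝ)) - θ ≤ c / 2 * Real.log (eK L e ε₀ d k)⁻¹ ^ (r - 1))
    (hAτ : (2 / (1 - (L ^ (-((4 - (d : ℝ)) / 2))) ^ ((nbar : ℝ) + 1 - α₁ - 2 * (d : ℝ) / (4 - (d : ℝ)) - θ)) + 8) *
      eK L e ε₀ d k ^ τ ≤ 1) :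
    Ineq5714 (cubePolymers ι₀)
      (fun X => ∑ j ∈ Finset.range (k + 1), (F₁.W j X + F₂.W j X + F₃.W j X + F₄.W j X + F₅.W j X + F₆.W j X))
      k (fun j => eK L e ε₀ d j) lfVol
      (((nbar : ℝ) + 1 - α₁ - 2 * (d : ℝ) / (4 - (d : ℝ)) - θ) - τ) (α + τ) (c / 2) (rLen r (eK L e ε₀ d k)) :=
  have hL0 : 0 < L := by linarith
  ineq5714_wordModel hL he hε₀ hd k hek1 hr hc hτ hκ F₁ F₂ F₃ F₄ F₅ F₆ R₂ R₆ lfVol hvol₂ hvol₆ h1 h2 h2k.hCs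
    (fun X => h2k.s1_shape hs (BIJ88ScaleSums.eK_pos hL0 he hε₀ k).le hcr hsmall X) h3 h4 h5 h6 h6k hg hκR hAτ

end BridgeClosed

end Literature.MathematicalPhysics.QuantumFieldTheory.BalabanImbrieJaffe1984to88.BIJ88Ineq5714Bridge
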